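import Mathlib.Analysis.SpecialFunctions.Exp
import Mathlib.Analysis.SpecialFunctions.Pow.Real
import Literature.Computability.Complexity.Randomized
import Literature.Computability.Cryptography.StatisticalDistance
import HarnessLib

/-!
# Schöning's random walk for k-SAT, I: the probability estimates

Topic `Literature/Computability/FineGrained`, groundwork for the discharge of the named fact
`Literature.Computability.FineGrained.schoening` (Schöning, FOCS 1999: k-SAT ∈
BPTIME(`(2 - 2/k)^n · poly`)), following the exposition of Fomin–Kratsch, *Exact Exponential
Algorithms*, §8.1 (Lemma 8.1, Theorem 8.3) — with one deliberate change of proof, explained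
below. Everything here is elementary real arithmetic over finite averages; the algorithm, its
functional specification and its stack machine are in the sequel files.

## Contents

* averages over coin strings: we use the tree's `uniformAvg m f` (the average of
  `f : List Bool → ℝ` over the `2^m` strings of length `m`, `Cryptography/StatisticalDistance.lean`)
  and prove here its computation rule `uniformAvg_succ` (condition on the first coin), from
  which linearity, monotonicity and `uniformAvg_append` (splitting a string into a prefix and a
  suffix — the only "independence" ever used) follow by induction; `uniformProb_eq_uniformAvg`
  is the bridge to the counting probability `uniformProb` of `Randomized.lean`. (Generic lemmas of
  this kind also exist, scattered and specialised, in the `Cryptography/` files — e.g.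
  `HybridSampling.uniformAvg_append`, `LiuPassPadding.uniformAvg_const`, and the Boolean
  indicator `PRGfromPRF.ind` with its three one-line lemmas; the small self-contained suite here
  keeps the import closure of the fine-grained files free of the cryptographic developments.)
* `hit pd ps pu T j` — the probability that the *lazy* random walk on `ℕ` (down with
  probability `pd`, stay `ps`, up `pu`) started at `j` reaches `0` within `T` steps, as the
  solution of its recursion; `0 ≤ hit ≤ 1`, antitone in `j`, monotone in `T`.
* `rho_pow_sub_hit_le` — **the walk estimate**: with `ρ = pd / pu ≤ 1` (drift away from `0`),
  `ρ ^ j - hit T j ≤ x ^ j · A ^ T` for every `x ∈ [ρ, 1]`, `A = pd / x + ps + pu · x`; whence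
  `hit T j ≥ ρ ^ j - A ^ T` (`rho_pow_sub_pow_le_hit`). For Schöning's parameters
  (`pd = 1/K`, `pu = (k-1)/K`, `ps = 1 - k/K`, `3 ≤ k ≤ K`; `ρ = 1/(k-1)`) and `x = 2/3`:
  `A ≤ 1 - 1/(6K)` (`schoeningA_le`) and `(1 - 1/(6K)) ^ (6 K (n+1)) ≤ 2^{-(n+1)}`
  (`one_sub_pow_le_half_pow`), giving `schoening_hit_ge`.
* `uniformAvg_hits_ge_hit` — **the comparison lemma** ("pessimistic view", Fomin–Kratsch p. 138, made
  precise): a process on states `σ` driven by blocks of `kk` fresh coins, with an invariant and a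
  potential
  `d : σ → ℕ` that vanishes only on good states, never increases by more than one per step,
  decreases with (conditional) probability `≥ pd` and does not increase with probability
  `≥ pd + ps`, reaches a good state within `T` steps with probability `≥ hit pd ps pu T (d s)`.
* `uniformAvg_rho_pow_mismatches` — averaging over a uniformly random initial assignment:
  `𝔼 ρ^{dist(a, a*)} = ((1 + ρ)/2)^n` (for `ρ = 1/(k-1)` this is `(2 - 2/k)^{-n}`,
  `half_add_inv_eq`), coordinate by coordinate (no binomial identities).
* `uniformAvg_trialsFail_le` and `one_sub_pow_le_third` — independent repetitions on disjoint coin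
  blocks: `t` trials of success probability `≥ p` all fail with probability `≤ (1-p)^t ≤ e^{-pt}`,
  which is `< 1/3` once `p t ≥ 2`.

## The change of proof

The printed proofs (Schöning 1999; Fomin–Kratsch Lemma 8.1; Hromkovič 2001, Thm 5.3.7.2 for
`k = 3`) bound the `3n`-step walk from distance `j` below by one term
`C(j+2i, i) (1/k)^{j+i} ((k-1)/k)^i` and evaluate it with Stirling's formula / the binary entropy
bound, losing a polynomial factor. We use instead the harmonic function `ρ^j` of the walk
(`ρ = pd/pu`; gambler's ruin): `ρ^j - hit T j` satisfies the same recursion with vanishing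
boundary values, and comparing it with the supersolution `x^j A^T` gives
`hit T j ≥ ρ^j - A^T` with `A < 1` — an exponentially small loss for walks of length `O(K n)`,
and then `Σ_j C(n,j) 2^{-n} ρ^j = ((1+ρ)/2)^n = (2 - 2/k)^{-n}` exactly as in the printed proof.
The walk implemented in the sequel is *lazy* (a step reads `k` coins and flips the `i`-th literal
of the first violated clause iff exactly the `i`-th coin is set; otherwise it does nothing),
because a stack machine reads coins, not uniform elements of `{1, …, k}`; laziness only rescales
the walk length (`ps = 1 - k/2^k`).

## References

* U. Schöning, *A probabilistic algorithm for k-SAT and constraint satisfaction problems*,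
  FOCS 1999, 410–414 (the algorithm and the bound `(2 - 2/k)^n`; not held, cited through the
  two textbooks below). [SchoeningFOCS1999]
* F. V. Fomin, D. Kratsch, *Exact Exponential Algorithms*, Springer 2010, §8.1, Lemma 8.1 and
  Theorem 8.3 (held; read pp. 137–140). [FominKratsch2010]
* J. Hromkovič, *Algorithmics for Hard Problems*, Springer 2001, §5.3.7, Theorem 5.3.7.2
  (`k = 3`) and Exercise 5.3.7.3 (`k ≥ 4`) (held; read pp. 417–421).
-/

namespace Literature.Computability.FineGrained.Schoening

open Literature.Computability.Complexity Literature.Computability.Cryptography Finset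

/-! ### Averages over bit strings of a fixed length -/

/-- Bit strings of length `m + 1` are a first bit and a string of length `m`. [folklore] -/
def vectorSuccEquiv (m : ℕ) : List.Vector Bool (m + 1) ≃ Bool × List.Vector Bool m where
  toFun v := (v.head, v.tail)
  invFun p := p.1 ::ᵥ p.2
  left_inv v := List.Vector.cons_head_tail v
  right_inv p := by simp

/-- `uniformAvg 0 f = f []` (the only string of length `0`). [folklore] -/
@[simp] theorem uniformAvg_zero (f : List Bool → ℝ) : uniformAvg 0 f = f [] := by
  unfold uniformAvg
  rw [Fintype.sum_eq_single (List.Vector.nil : List.Vector Bool 0)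
    fun v hv => absurd (List.Vector.eq_nil v) hv]
  simp

/-- **Conditioning on the first coin**: the computation rule by which every average below is
evaluated. [folklore] -/
theorem uniformAvg_succ (m : ℕ) (f : List Bool → ℝ) :
    uniformAvg (m + 1) f =
      (uniformAvg m (fun l => f (false :: l)) + uniformAvg m (fun l => f (true :: l))) / 2 := by
  unfold uniformAvg
  rw [← (vectorSuccEquiv m).symm.sum_comp, Fintype.sum_prod_type, Fintype.sum_bool]
  simp only [vectorSuccEquiv, Equiv.coe_fn_symm_mk, List.Vector.toList_cons, pow_succ]
  field_simp
  ring

/-- The average of a constant. [folklore] -/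
@[simp] theorem uniformAvg_const (m : ℕ) (c : ℝ) : uniformAvg m (fun _ => c) = c := by
  induction m with
  | zero => rw [uniformAvg_zero]
  | succ m ih => rw [uniformAvg_succ, ih]; ring

/-- Linearity: sums. [folklore] -/
theorem uniformAvg_add (m : ℕ) (f g : List Bool → ℝ) :
    uniformAvg m (fun l => f l + g l) = uniformAvg m f + uniformAvg m g := by
  induction m generalizing f g with
  | zero => simp
  | succ m ih => simp only [uniformAvg_succ, ih]; ring

/-- Linearity: scalars. [folklore] -/
theorem uniformAvg_mul_left (m : ℕ) (c : ℝ) (f : List Bool → ℝ) :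
    uniformAvg m (fun l => c * f l) = c * uniformAvg m f := by
  induction m generalizing f with
  | zero => simp
  | succ m ih => simp only [uniformAvg_succ, ih]; ring

/-- Linearity: scalars on the right. [folklore] -/
theorem uniformAvg_mul_right (m : ℕ) (c : ℝ) (f : List Bool → ℝ) :
    uniformAvg m (fun l => f l * c) = uniformAvg m f * c := by
  rw [mul_comm, ← uniformAvg_mul_left]; exact congrArg _ (funext fun l => mul_comm _ _)

/-- Linearity: differences. [folklore] -/
theorem uniformAvg_sub (m : ℕ) (f g : List Bool → ℝ) :
    uniformAvg m (fun l => f l - g l) = uniformAvg m f - uniformAvg m g := by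
  induction m generalizing f g with
  | zero => simp
  | succ m ih => simp only [uniformAvg_succ, ih]; ring

/-- Linearity: finite sums. [folklore] -/
theorem uniformAvg_finset_sum {ι : Type} (m : ℕ) (S : Finset ι) (f : ι → List Bool → ℝ) :
    uniformAvg m (fun l => ∑ i ∈ S, f i l) = ∑ i ∈ S, uniformAvg m (f i) := by
  classical
  induction S using Finset.induction_on with
  | empty => simp
  | insert a S ha ih =>
    simp only [Finset.sum_insert ha]
    rw [← ih, ← uniformAvg_add]

/-- Only the values on strings of length `m` matter. [folklore] -/
theorem uniformAvg_congr_length {m : ℕ} {f g : List Bool → ℝ} (h : ∀ l, l.length = m → f l = g l) :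
    uniformAvg m f = uniformAvg m g := by
  induction m generalizing f g with
  | zero => simpa using h [] rfl
  | succ m ih =>
    simp only [uniformAvg_succ]
    rw [ih (f := fun l => f (false :: l)) (g := fun l => g (false :: l))
        fun l hl => h _ (by simp [hl]),
      ih (f := fun l => f (true :: l)) (g := fun l => g (true :: l))
        fun l hl => h _ (by simp [hl])]

/-- Monotonicity (it suffices to compare on strings of length `m`). [folklore] -/
theorem uniformAvg_mono {m : ℕ} {f g : List Bool → ℝ} (h : ∀ l, l.length = m → f l ≤ g l) :
    uniformAvg m f ≤ uniformAvg m g := by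
  induction m generalizing f g with
  | zero => simpa using h [] rfl
  | succ m ih =>
    simp only [uniformAvg_succ]
    have h₁ := ih (f := fun l => f (false :: l)) (g := fun l => g (false :: l))
      fun l hl => h _ (by simp [hl])
    have h₂ := ih (f := fun l => f (true :: l)) (g := fun l => g (true :: l))
      fun l hl => h _ (by simp [hl])
    linarith

/-- A pointwise nonnegative function has a nonnegative average. [folklore] -/
theorem uniformAvg_nonneg {m : ℕ} {f : List Bool → ℝ} (h : ∀ l, l.length = m → 0 ≤ f l) : 0 ≤ uniformAvg m f :=
  le_of_eq_of_le (uniformAvg_const m 0).symm (uniformAvg_mono h)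

/-- A function bounded by `1` pointwise has average at most `1`. [folklore] -/
theorem uniformAvg_le_one {m : ℕ} {f : List Bool → ℝ} (h : ∀ l, l.length = m → f l ≤ 1) : uniformAvg m f ≤ 1 :=
  (uniformAvg_mono h).trans_eq (uniformAvg_const m 1)

/-- **Splitting a coin string**: the average over strings of length `a + b` is the average
over prefixes `u` of length `a` of the average over suffixes `w` of length `b` of `f (u ++ w)`.
This is the independence of disjoint coin blocks. [folklore] -/
theorem uniformAvg_append (a b : ℕ) (f : List Bool → ℝ) :
    uniformAvg (a + b) f = uniformAvg a (fun u => uniformAvg b (fun w => f (u ++ w))) := by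
  induction a generalizing f with
  | zero => simp
  | succ a ih =>
    rw [Nat.succ_add, uniformAvg_succ, uniformAvg_succ, ih, ih]
    rfl

/-- The indicator of a Boolean. [folklore] -/
def ind (b : Bool) : ℝ := if b then 1 else 0

/-- `ind true = 1`. [folklore] -/
@[simp] theorem ind_true : ind true = 1 := rfl

/-- `ind false = 0`. [folklore] -/
@[simp] theorem ind_false : ind false = 0 := rfl

/-- `0 ≤ ind b`. [folklore] -/
theorem ind_nonneg (b : Bool) : 0 ≤ ind b := by cases b <;> simp

/-- `ind b ≤ 1`. [folklore] -/
theorem ind_le_one (b : Bool) : ind b ≤ 1 := by cases b <;> simp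

/-- `ind` is monotone along implication. [folklore] -/
theorem ind_le_ind {b c : Bool} (h : b = true → c = true) : ind b ≤ ind c := by
  cases b <;> cases c <;> simp_all

/-- `ind (!b) = 1 - ind b`. [folklore] -/
theorem ind_not (b : Bool) : ind (!b) = 1 - ind b := by cases b <;> simp

/-- `ind (b || c) ≤ ind b + ind c`. [folklore] -/
theorem ind_or_le (b c : Bool) : ind (b || c) ≤ ind b + ind c := by
  cases b <;> cases c <;> simp

/-- `ind (b && c) = ind b * ind c`. [folklore] -/
theorem ind_and (b c : Bool) : ind (b && c) = ind b * ind c := by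
  cases b <;> cases c <;> simp

/-- The average of the indicator of one particular string `w` of length `m` is `2^{-m}`.
[folklore] -/
theorem uniformAvg_ind_eq_single (w : List Bool) :
    uniformAvg w.length (fun l => ind (decide (l = w))) = 1 / 2 ^ w.length := by
  induction w with
  | nil => simp [ind]
  | cons b w ih =>
    rw [List.length_cons, uniformAvg_succ]
    have e1 : (fun l : List Bool => ind (decide (b :: l = b :: w))) = fun l => ind (decide (l = w)) := by
      funext l; simp
    have e2 : (fun l : List Bool => ind (decide ((!b) :: l = b :: w))) = fun _ => (0 : ℝ) := by
      funext l; cases b <;> simp [ind]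
    cases b
    · simp only [Bool.not_false] at e2
      rw [e1, e2, uniformAvg_const, ih, pow_succ]; ring
    · simp only [Bool.not_true] at e2
      rw [e1, e2, uniformAvg_const, ih, pow_succ]; ring

/-- Hence a nonnegative function which is `≥ 1` at some string of length `m` has average
`≥ 2^{-m}`. [folklore] -/
theorem uniformAvg_ge_of_apply_ge_one {m : ℕ} {f : List Bool → ℝ} (hf : ∀ l, l.length = m → 0 ≤ f l)
    {w : List Bool} (hw : w.length = m) (h1 : 1 ≤ f w) : 1 / 2 ^ m ≤ uniformAvg m f := by
  subst hw
  rw [← uniformAvg_ind_eq_single w]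
  refine uniformAvg_mono fun l hl => ?_
  by_cases h : l = w
  · subst h; simpa [ind] using h1
  · simpa [ind, h] using hf l hl

/-! ### The bridge to `uniformProb` -/

/-- **`uniformProb` is a uniform average**: the probability that a uniformly random string of
length `m` lies in `E` is the average of the indicator of `E`. (Arora–Barak 2009,
Def. 7.1–7.3.) [folklore] -/
theorem uniformProb_eq_uniformAvg (m : ℕ) (E : Set (List Bool)) [DecidablePred (· ∈ E)] :
    uniformProb m E = uniformAvg m (fun l => ind (decide (l ∈ E))) := by
  classical
  unfold uniformProb uniformAvg
  congr 1
  rw [Finset.card_filter]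
  push_cast
  refine Finset.sum_congr rfl fun v _ => ?_
  by_cases h : v.toList ∈ E <;> simp [ind, h]

/-! ### The lazy walk on `ℕ`: finite-horizon hitting probabilities -/

/-- `hit pd ps pu T j`: the probability that the lazy random walk on `ℕ` which moves down with
probability `pd`, stays with probability `ps` and moves up with probability `pu`, started at
`j`, visits `0` within `T` steps — defined as the solution of the first-step recursion
`hit T 0 = 1`, `hit 0 (j+1) = 0`, `hit (T+1) (j+1) = pd·hit T j + ps·hit T (j+1) + pu·hit T (j+2)`.
(Fomin–Kratsch 2010, proof of Lemma 8.1: "the probability of the event that a particle reaches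
0 in at most 3n moves starting from j"; here for the lazy walk.) [cite: FominKratsch2010, Lemma 8.1 (proof)] -/
def hit (pd ps pu : ℝ) : ℕ → ℕ → ℝ
  | _, 0 => 1
  | 0, _ + 1 => 0
  | T + 1, j + 1 => pd * hit pd ps pu T j + ps * hit pd ps pu T (j + 1) + pu * hit pd ps pu T (j + 2)

section Hit

variable {pd ps pu : ℝ}

/-- At `0` the walk has arrived. [folklore] -/
@[simp] theorem hit_zero_right (T : ℕ) : hit pd ps pu T 0 = 1 := by cases T <;> rfl

/-- Without steps a walk at `j + 1` has not arrived. [folklore] -/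
@[simp] theorem hit_zero_succ (j : ℕ) : hit pd ps pu 0 (j + 1) = 0 := rfl

/-- The first-step recursion. [folklore] -/
theorem hit_succ_succ (T j : ℕ) : hit pd ps pu (T + 1) (j + 1) =
    pd * hit pd ps pu T j + ps * hit pd ps pu T (j + 1) + pu * hit pd ps pu T (j + 2) := rfl

variable (hpd : 0 ≤ pd) (hps : 0 ≤ ps) (hpu : 0 ≤ pu) (hsum : pd + ps + pu = 1)
include hpd hps hpu hsum

/-- `0 ≤ hit T j ≤ 1`. [folklore] -/
theorem hit_mem_Icc : ∀ T j : ℕ, hit pd ps pu T j ∈ Set.Icc (0 : ℝ) 1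
  | _, 0 => by simp
  | 0, _ + 1 => by simp
  | T + 1, j + 1 => by
    rw [hit_succ_succ]
    have h₁ := hit_mem_Icc T j
    have h₂ := hit_mem_Icc T (j + 1)
    have h₃ := hit_mem_Icc T (j + 2)
    simp only [Set.mem_Icc] at h₁ h₂ h₃ ⊢
    constructor
    · have := mul_nonneg hpd h₁.1; have := mul_nonneg hps h₂.1; have := mul_nonneg hpu h₃.1
      linarith
    · have := mul_le_mul_of_nonneg_left h₁.2 hpd
      have := mul_le_mul_of_nonneg_left h₂.2 hps
      have := mul_le_mul_of_nonneg_left h₃.2 hpu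
      linarith

/-- `0 ≤ hit T j`. [folklore] -/
theorem hit_nonneg (T j : ℕ) : 0 ≤ hit pd ps pu T j := (hit_mem_Icc hpd hps hpu hsum T j).1

/-- `hit T j ≤ 1`. [folklore] -/
theorem hit_le_one (T j : ℕ) : hit pd ps pu T j ≤ 1 := (hit_mem_Icc hpd hps hpu hsum T j).2

/-- **Closer is better**: `hit T (j + 1) ≤ hit T j`. [folklore] -/
theorem hit_succ_le : ∀ T j : ℕ, hit pd ps pu T (j + 1) ≤ hit pd ps pu T j
  | 0, j => by rw [hit_zero_succ]; exact hit_nonneg hpd hps hpu hsum 0 j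
  | T + 1, 0 => by rw [hit_zero_right]; exact hit_le_one hpd hps hpu hsum _ _
  | T + 1, j + 1 => by
    rw [hit_succ_succ, hit_succ_succ]
    have h₁ := mul_le_mul_of_nonneg_left (hit_succ_le T j) hpd
    have h₂ := mul_le_mul_of_nonneg_left (hit_succ_le T (j + 1)) hps
    have h₃ := mul_le_mul_of_nonneg_left (hit_succ_le T (j + 2)) hpu
    linarith

/-- `hit T` is antitone in the starting point. [folklore] -/
theorem hit_antitone (T : ℕ) {i j : ℕ} (hij : i ≤ j) : hit pd ps pu T j ≤ hit pd ps pu T i := by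
  induction hij with
  | refl => exact le_rfl
  | step _ ih => exact (hit_succ_le hpd hps hpu hsum T _).trans ih

/-- **More steps are better**: `hit T j ≤ hit (T + 1) j`. [folklore] -/
theorem hit_le_succ : ∀ T j : ℕ, hit pd ps pu T j ≤ hit pd ps pu (T + 1) j
  | T, 0 => by simp
  | 0, j + 1 => by rw [hit_zero_succ]; exact hit_nonneg hpd hps hpu hsum _ _
  | T + 1, j + 1 => by
    rw [hit_succ_succ, hit_succ_succ]
    have h₁ := mul_le_mul_of_nonneg_left (hit_le_succ T j) hpd
    have h₂ := mul_le_mul_of_nonneg_left (hit_le_succ T (j + 1)) hps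
    have h₃ := mul_le_mul_of_nonneg_left (hit_le_succ T (j + 2)) hpu
    linarith

/-- `hit` is monotone in the number of steps. [folklore] -/
theorem hit_mono_steps {T T' : ℕ} (hT : T ≤ T') (j : ℕ) : hit pd ps pu T j ≤ hit pd ps pu T' j := by
  induction hT with
  | refl => exact le_rfl
  | step _ ih => exact ih.trans (hit_le_succ hpd hps hpu hsum _ _)

/-- **The walk estimate** (gambler's ruin, finite horizon). Let `ρ = pd / pu` (so that `ρ^j`
is harmonic for the walk: `pd ρ^{j-1} + ps ρ^j + pu ρ^{j+1} = ρ^j`) and let `x ∈ [ρ, 1]`,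
`x > 0`, `A = pd/x + ps + pu·x`. Then `ρ^j - hit T j ≤ x^j · A^T`: the difference satisfies the
walk's recursion with boundary values `0` at `j = 0` and `ρ^j ≤ x^j` at `T = 0`, and `x^j A^T`
is a supersolution. (Replaces the Stirling-formula estimate of Fomin–Kratsch 2010, Lemma 8.1 /
Schöning 1999; see the module docstring.) [folklore] -/
theorem rho_pow_sub_hit_le (hpu' : 0 < pu) {x : ℝ} (hx : 0 < x) (hρx : pd / pu ≤ x) (hx1 : x ≤ 1) :
    ∀ T j : ℕ, (pd / pu) ^ j - hit pd ps pu T j ≤ x ^ j * (pd / x + ps + pu * x) ^ T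
  | T, 0 => by
    simp only [pow_zero, hit_zero_right, sub_self, one_mul]
    exact pow_nonneg (by positivity) T
  | 0, j + 1 => by
    rw [hit_zero_succ, sub_zero, pow_zero, mul_one]
    exact pow_le_pow_left₀ (by positivity) hρx _
  | T + 1, j + 1 => by
    set ρ := pd / pu with hρ
    set A := pd / x + ps + pu * x with hA
    have h₁ := rho_pow_sub_hit_le hpu' hx hρx hx1 T j
    have h₂ := rho_pow_sub_hit_le hpu' hx hρx hx1 T (j + 1)
    have h₃ := rho_pow_sub_hit_le hpu' hx hρx hx1 T (j + 2)
    rw [← hρ, ← hA] at h₁ h₂ h₃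
    -- harmonicity of `ρ^j`
    have hpuρ : pu * ρ = pd := by rw [hρ]; field_simp
    have harm : ρ ^ (j + 1) = pd * ρ ^ j + ps * ρ ^ (j + 1) + pu * ρ ^ (j + 2) := by
      have e1 : pd * ρ ^ j = pu * ρ ^ (j + 1) := by rw [pow_succ, ← hpuρ]; ring
      have e2 : pu * ρ ^ (j + 2) = pd * ρ ^ (j + 1) := by rw [pow_succ, ← hpuρ]; ring
      rw [e1, e2]
      calc ρ ^ (j + 1) = (pd + ps + pu) * ρ ^ (j + 1) := by rw [hsum, one_mul]
        _ = pu * ρ ^ (j + 1) + ps * ρ ^ (j + 1) + pd * ρ ^ (j + 1) := by ring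
    rw [hit_succ_succ, harm]
    have hA0 : 0 ≤ A := by rw [hA]; positivity
    have hxA : x ^ (j + 1) * A ^ (T + 1) =
        pd * (x ^ j * A ^ T) + ps * (x ^ (j + 1) * A ^ T) + pu * (x ^ (j + 2) * A ^ T) := by
      rw [hA, pow_succ _ T, pow_succ, pow_succ, pow_succ]
      field_simp
    rw [hxA]
    have k₁ := mul_le_mul_of_nonneg_left h₁ hpd
    have k₂ := mul_le_mul_of_nonneg_left h₂ hps
    have k₃ := mul_le_mul_of_nonneg_left h₃ hpu
    linarith

/-- Consequently `hit T j ≥ ρ^j - A^T` (`x^j ≤ 1`). [folklore] -/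
theorem rho_pow_sub_pow_le_hit (hpu' : 0 < pu) {x : ℝ} (hx : 0 < x) (hρx : pd / pu ≤ x)
    (hx1 : x ≤ 1) (T j : ℕ) :
    (pd / pu) ^ j - (pd / x + ps + pu * x) ^ T ≤ hit pd ps pu T j := by
  have h := rho_pow_sub_hit_le hpd hps hpu hsum hpu' hx hρx hx1 T j
  have hA : 0 ≤ (pd / x + ps + pu * x) ^ T := pow_nonneg (by positivity) T
  have hxj : x ^ j ≤ 1 := pow_le_one₀ hx.le hx1
  have := mul_le_of_le_one_left hA hxj
  linarith

end Hit

/-! ### Schöning's parameters -/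

section Params

variable {k K : ℕ}

/-- The exponent identity behind `(2 - 2/k)^n`: `(1 + 1/(k-1))/2 = 1/(2 - 2/k)` for `k ≥ 2`.
(Fomin–Kratsch 2010, end of the proof of Lemma 8.1: `(1/2)^n (1 + 1/(k-1))^n = (k/(2(k-1)))^n`.)
[cite: FominKratsch2010, Lemma 8.1 (proof)] -/
theorem half_add_inv_eq (hk : 2 ≤ k) : (1 + 1 / ((k : ℝ) - 1)) / 2 = 1 / (2 - 2 / (k : ℝ)) := by
  have hk' : (2 : ℝ) ≤ k := by exact_mod_cast hk
  have h1 : (k : ℝ) - 1 ≠ 0 := by linarith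
  have h2 : (k : ℝ) ≠ 0 := by linarith
  have h3 : (2 : ℝ) - 2 / k ≠ 0 := by
    have : (2 : ℝ) / k ≤ 1 := by rw [div_le_one (by linarith)]; linarith
    linarith
  field_simp
  ring

/-- For Schöning's lazy walk (`pd = 1/K`, `ps = 1 - k/K`, `pu = (k-1)/K`) the ratio `pd/pu` is
`1/(k-1)`. [folklore] -/
theorem pd_div_pu_eq (hk : 2 ≤ k) (hK : 0 < K) :
    (1 / (K : ℝ)) / (((k : ℝ) - 1) / K) = 1 / ((k : ℝ) - 1) := by
  have hk' : (2 : ℝ) ≤ k := by exact_mod_cast hk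
  have hK' : (0 : ℝ) < K := by exact_mod_cast hK
  have h1 : (k : ℝ) - 1 ≠ 0 := by linarith
  field_simp

/-- With `x = 2/3` the contraction factor of Schöning's lazy walk is
`A = 1 - (2k - 5)/(6K) ≤ 1 - 1/(6K)` for `k ≥ 3`. [folklore] -/
theorem schoeningA_le (hk : 3 ≤ k) (hK : 0 < K) :
    (1 / (K : ℝ)) / (2 / 3) + (1 - (k : ℝ) / K) + ((k : ℝ) - 1) / K * (2 / 3) ≤
      1 - 1 / (6 * (K : ℝ)) := by
  have hk' : (3 : ℝ) ≤ k := by exact_mod_cast hk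
  have hK' : (0 : ℝ) < K := by exact_mod_cast hK
  have e : (1 / (K : ℝ)) / (2 / 3) + (1 - (k : ℝ) / K) + ((k : ℝ) - 1) / K * (2 / 3) =
      1 - (2 * (k : ℝ) - 5) / (6 * K) := by
    field_simp; ring
  rw [e]
  have : (1 : ℝ) / (6 * K) ≤ (2 * (k : ℝ) - 5) / (6 * K) :=
    div_le_div_of_nonneg_right (by linarith) (by positivity)
  linarith

/-- `(1 - 1/(6K))^{6K(n+1)} ≤ 2^{-(n+1)}` (from `1 - y ≤ e^{-y}` and `2 ≤ e`). [folklore] -/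
theorem one_sub_pow_le_half_pow (hK : 0 < K) (n : ℕ) :
    (1 - 1 / (6 * (K : ℝ))) ^ (6 * K * (n + 1)) ≤ 1 / 2 ^ (n + 1) := by
  have hK' : (0 : ℝ) < K := by exact_mod_cast hK
  set y : ℝ := 1 / (6 * K) with hy
  have hy0 : 0 ≤ 1 - y := by
    rw [hy, sub_nonneg, div_le_one (by positivity)]
    have : (1 : ℝ) ≤ K := by exact_mod_cast hK
    linarith
  have h1 : 1 - y ≤ Real.exp (-y) := by
    have := Real.add_one_le_exp (-y); linarith
  have h2 : (1 - y) ^ (6 * K * (n + 1)) ≤ Real.exp (-y) ^ (6 * K * (n + 1)) :=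
    pow_le_pow_left₀ hy0 h1 _
  have h3 : Real.exp (-y) ^ (6 * K * (n + 1)) = Real.exp (-1) ^ (n + 1) := by
    rw [← Real.exp_nat_mul, ← Real.exp_nat_mul]
    congr 1
    rw [hy]; push_cast; field_simp
  have h4 : Real.exp (-1) ≤ 1 / 2 := by
    rw [Real.exp_neg, one_div]
    have h2e : (2 : ℝ) ≤ Real.exp 1 := by have := Real.add_one_le_exp (1 : ℝ); linarith
    exact inv_anti₀ (by norm_num) h2e
  calc (1 - y) ^ (6 * K * (n + 1)) ≤ Real.exp (-1) ^ (n + 1) := h2.trans_eq h3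
    _ ≤ (1 / 2) ^ (n + 1) := pow_le_pow_left₀ (Real.exp_nonneg _) h4 _
    _ = 1 / 2 ^ (n + 1) := by rw [one_div_pow]

/-- **Schöning's walk bound**: for `3 ≤ k ≤ K` the lazy walk with `pd = 1/K`, `ps = 1 - k/K`,
`pu = (k-1)/K` reaches `0` from `j` within `6K(n+1)` steps with probability at least
`(1/(k-1))^j - 2^{-(n+1)}`. (Fomin–Kratsch 2010, Lemma 8.1: `q_j ≥ (1/(k-1))^j / poly`.)
[cite: FominKratsch2010, Lemma 8.1] -/
theorem schoening_hit_ge (hk : 3 ≤ k) (hkK : k ≤ K) (n j : ℕ) {T : ℕ} (hT : 6 * K * (n + 1) ≤ T) :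
    (1 / ((k : ℝ) - 1)) ^ j - 1 / 2 ^ (n + 1) ≤
      hit (1 / K) (1 - (k : ℝ) / K) (((k : ℝ) - 1) / K) T j := by
  have hK : 0 < K := by omega
  have hk' : (3 : ℝ) ≤ k := by exact_mod_cast hk
  have hK' : (0 : ℝ) < K := by exact_mod_cast hK
  have hkK' : (k : ℝ) ≤ K := by exact_mod_cast hkK
  have hpd : (0 : ℝ) ≤ 1 / K := by positivity
  have hps : (0 : ℝ) ≤ 1 - (k : ℝ) / K := by
    rw [sub_nonneg, div_le_one hK']; exact hkK'
  have hpu : (0 : ℝ) < ((k : ℝ) - 1) / K := by apply div_pos <;> linarith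
  have hsum : 1 / (K : ℝ) + (1 - (k : ℝ) / K) + ((k : ℝ) - 1) / K = 1 := by
    field_simp; ring
  have hρ := pd_div_pu_eq (k := k) (K := K) (by omega) hK
  have hx : (0 : ℝ) < 2 / 3 := by norm_num
  have hρx : (1 / (K : ℝ)) / (((k : ℝ) - 1) / K) ≤ 2 / 3 := by
    rw [hρ, div_le_div_iff₀ (by linarith) (by norm_num)]; linarith
  have h := rho_pow_sub_pow_le_hit hpd hps hpu.le hsum hpu hx hρx (by norm_num) T j
  rw [hρ] at h
  refine le_trans ?_ h
  have hA := schoeningA_le hk hK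
  have hA0 : (0 : ℝ) ≤ (1 / (K : ℝ)) / (2 / 3) + (1 - (k : ℝ) / K) + ((k : ℝ) - 1) / K * (2 / 3) := by
    positivity
  have hB : ((1 / (K : ℝ)) / (2 / 3) + (1 - (k : ℝ) / K) + ((k : ℝ) - 1) / K * (2 / 3)) ^ T ≤
      1 / 2 ^ (n + 1) := by
    calc _ ≤ (1 - 1 / (6 * (K : ℝ))) ^ T := pow_le_pow_left₀ hA0 hA T
      _ ≤ (1 - 1 / (6 * (K : ℝ))) ^ (6 * K * (n + 1)) := by
          apply pow_le_pow_of_le_one (hA0.trans hA) _ hT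
          have : (0 : ℝ) < 1 / (6 * K) := by positivity
          linarith
      _ ≤ 1 / 2 ^ (n + 1) := one_sub_pow_le_half_pow hK n
  linarith

end Params

/-! ### The comparison lemma -/

section Compare

variable {σ : Type} (step : σ → List Bool → σ) (good : σ → Bool) (kk : ℕ)

/-- `hits step good kk T s c`: driving the process from `s` with the coin string `c`, `kk`
coins per step (`s ↦ step s (next kk coins)`), some state among the first `T + 1` (the start
included) is good. [folklore] -/
def hits : ℕ → σ → List Bool → Bool
  | 0, s, _ => good s
  | T + 1, s, c => good s || hits T (step s (c.take kk)) (c.drop kk)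

/-- `hits 0` looks at the start only. [folklore] -/
@[simp] theorem hits_zero (s : σ) (c : List Bool) : hits step good kk 0 s c = good s := rfl

/-- `hits (T + 1)` unrolled once. [folklore] -/
theorem hits_succ (T : ℕ) (s : σ) (c : List Bool) : hits step good kk (T + 1) s c =
    (good s || hits step good kk T (step s (c.take kk)) (c.drop kk)) := rfl

/-- A good start is a hit. [folklore] -/
theorem hits_of_good {s : σ} (h : good s = true) (T : ℕ) (c : List Bool) :
    hits step good kk T s c = true := by
  cases T <;> simp [hits, h]

/-- `hits T` reads only the first `kk · T` coins. [folklore] -/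
theorem hits_append : ∀ (T : ℕ) (s : σ) (w e : List Bool), w.length = kk * T →
    hits step good kk T s (w ++ e) = hits step good kk T s w
  | 0, s, w, e, _ => rfl
  | T + 1, s, w, e, hw => by
    have hk : kk ≤ w.length := by rw [hw, Nat.mul_succ]; omega
    rw [hits_succ, hits_succ, List.take_append_of_le_length hk, List.drop_append_of_le_length hk,
      hits_append T _ (w.drop kk) e (by rw [List.length_drop, hw, Nat.mul_succ]; omega)]

/-- `trials`-style readers: `hits T` depends only on the first `kk · T` coins (`take` form).
[folklore] -/
theorem hits_take (T : ℕ) (s : σ) (w : List Bool) (hw : kk * T ≤ w.length) :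
    hits step good kk T s (w.take (kk * T)) = hits step good kk T s w := by
  conv_rhs => rw [← List.take_append_drop (kk * T) w]
  rw [hits_append step good kk T s _ _ (by rw [List.length_take]; omega)]

variable {step good kk}

/-- **The comparison lemma** (the "pessimistic view" of Fomin–Kratsch 2010, p. 138, made
precise). Suppose an invariant `I` of the process and a potential `d : σ → ℕ` are given such
that, on invariant states, `d` vanishes only on good states and, from every invariant state `s`
that is not good, one step driven by `kk` fresh coins never increases `d` by more than one,
decreases it by one with probability at least `pd`, and does not increase it with probability
at least `pd + ps` (`pd + ps + pu = 1`). Then from an invariant state `s` a good state is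
reached within `T` steps with probability at least `hit pd ps pu T (d s)`: by induction on `T`,
averaging the induction hypothesis over the first block of coins and using that `hit T` is
antitone in the distance. [cite: FominKratsch2010, Lemma 8.1 (proof)] -/
theorem uniformAvg_hits_ge_hit {pd ps pu : ℝ} (hpd : 0 ≤ pd) (hps : 0 ≤ ps) (hpu : 0 ≤ pu)
    (hsum : pd + ps + pu = 1) (I : σ → Prop) (d : σ → ℕ)
    (hI : ∀ s, I s → ∀ ω : List Bool, ω.length = kk → I (step s ω))
    (hgood : ∀ s, I s → d s = 0 → good s = true)
    (hle : ∀ s, I s → good s = false → ∀ ω : List Bool, ω.length = kk → d (step s ω) ≤ d s + 1)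
    (hdown : ∀ s, I s → good s = false →
      pd ≤ uniformAvg kk (fun ω => ind (decide (d (step s ω) + 1 = d s))))
    (hstay : ∀ s, I s → good s = false →
      pd + ps ≤ uniformAvg kk (fun ω => ind (decide (d (step s ω) ≤ d s)))) :
    ∀ (T : ℕ) (s : σ), I s →
      hit pd ps pu T (d s) ≤ uniformAvg (kk * T) (fun c => ind (hits step good kk T s c)) := by
  intro T
  induction T with
  | zero =>
    intro s hs0
    rw [mul_zero, uniformAvg_zero, hits_zero]
    cases hs : good s
    · obtain ⟨j, hj⟩ : ∃ j, d s = j + 1 :=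
        Nat.exists_eq_add_one.2 (Nat.pos_of_ne_zero fun h0 => by simp [hgood s hs0 h0] at hs)
      rw [hj, hit_zero_succ, ind_false]
    · rw [ind_true]; exact hit_le_one hpd hps hpu hsum _ _
  | succ T ih =>
    intro s hs0
    cases hs : good s
    · -- not good: condition on the first block of coins
      obtain ⟨j, hj⟩ : ∃ j, d s = j + 1 :=
        Nat.exists_eq_add_one.2 (Nat.pos_of_ne_zero fun h0 => by simp [hgood s hs0 h0] at hs)
      rw [Nat.mul_succ, Nat.add_comm (kk * T) kk, uniformAvg_append]
      -- the inner average is the induction hypothesis at the next state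
      have inner : ∀ ω : List Bool, ω.length = kk →
          hit pd ps pu T (d (step s ω)) ≤
            uniformAvg (kk * T) (fun w => ind (hits step good kk (T + 1) s (ω ++ w))) := by
        intro ω hω
        refine (ih (step s ω) (hI s hs0 ω hω)).trans_eq (uniformAvg_congr_length fun w _ => ?_)
        rw [hits_succ, hs, Bool.false_or, List.take_left' hω, List.drop_left' hω]
      refine le_trans ?_ (uniformAvg_mono inner)
      -- pointwise lower bound of `hit T (d (step s ω))` by indicators
      set h := hit pd ps pu T with hh
      have hanti : ∀ {a b : ℕ}, a ≤ b → h b ≤ h a := fun hab => hit_antitone hpd hps hpu hsum T hab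
      have hpt : ∀ ω : List Bool, ω.length = kk →
          ind (decide (d (step s ω) + 1 = d s)) * (h j - h (j + 1)) +
            ind (decide (d (step s ω) ≤ d s)) * (h (j + 1) - h (j + 2)) + h (j + 2) ≤
            h (d (step s ω)) := by
        intro ω hω
        have hle' := hle s hs0 hs ω hω
        rw [hj] at hle' ⊢
        by_cases h1 : d (step s ω) + 1 = j + 1
        · have h1' : d (step s ω) = j := by omega
          simp [h1', ind]
        · by_cases h2 : d (step s ω) ≤ j + 1
          · rw [decide_eq_false h1, decide_eq_true h2, ind_false, ind_true, zero_mul, one_mul,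
              zero_add]
            have := hanti h2
            linarith
          · have h3 : d (step s ω) = j + 2 := by omega
            rw [decide_eq_false h1, decide_eq_false h2, ind_false, zero_mul, zero_mul, zero_add,
              zero_add, h3]
      refine le_trans ?_ (uniformAvg_mono hpt)
      rw [uniformAvg_add, uniformAvg_add, uniformAvg_const, uniformAvg_mul_right, uniformAvg_mul_right]
      have lhs : hit pd ps pu (T + 1) (d s) = pd * h j + ps * h (j + 1) + pu * h (j + 2) := by
        rw [hj, hit_succ_succ]
      rw [lhs]
      have g1 : 0 ≤ h j - h (j + 1) := sub_nonneg.2 (hanti (Nat.le_succ j))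
      have g2 : 0 ≤ h (j + 1) - h (j + 2) := sub_nonneg.2 (hanti (Nat.le_succ (j + 1)))
      have m1 := mul_le_mul_of_nonneg_right (hdown s hs0 hs) g1
      have m2 := mul_le_mul_of_nonneg_right (hstay s hs0 hs) g2
      have hpu' : pu = 1 - pd - ps := by linarith
      rw [hpu']
      linarith
    · -- good start: probability one
      have h1 : uniformAvg (kk * (T + 1)) (fun c => ind (hits step good kk (T + 1) s c)) = 1 := by
        rw [← uniformAvg_const (kk * (T + 1)) 1]
        exact congrArg _ (funext fun c => by rw [hits_of_good step good kk hs, ind_true])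
      rw [h1]
      exact hit_le_one hpd hps hpu hsum _ _

end Compare

/-! ### The random initial assignment -/

/-- `mismatches ts cs`: the number of positions at which the coin string `cs` disagrees with
the target bits `ts` (positions beyond the end of `cs` count as mismatches iff the target bit is
`true`, i.e. missing coins read as `false`). In the application `ts` lists the values of a fixed
satisfying assignment on the variables in order of first occurrence and `cs` the coins of the
random initial assignment, so that `mismatches ts cs` is their Hamming distance.
(Fomin–Kratsch 2010, Lemma 8.1: `p_j = C(n,j) 2^{-n}`.) [folklore] -/
def mismatches : List Bool → List Bool → ℕ
  | [], _ => 0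
  | t :: ts, [] => (if t then 1 else 0) + mismatches ts []
  | t :: ts, c :: cs => (if c = t then 0 else 1) + mismatches ts cs

/-- No targets, no mismatches. [folklore] -/
@[simp] theorem mismatches_nil (cs : List Bool) : mismatches [] cs = 0 := by cases cs <;> rfl

/-- One more target and coin. [folklore] -/
@[simp] theorem mismatches_cons_cons (t c : Bool) (ts cs : List Bool) :
    mismatches (t :: ts) (c :: cs) = (if c = t then 0 else 1) + mismatches ts cs := rfl

/-- `mismatches` reads only the first `|ts|` coins. [folklore] -/
theorem mismatches_append (ts cs w : List Bool) (h : cs.length = ts.length) :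
    mismatches ts (cs ++ w) = mismatches ts cs := by
  induction ts generalizing cs with
  | nil => simp
  | cons t ts ih =>
    cases cs with
    | nil => simp at h
    | cons c cs => simp only [List.cons_append, mismatches_cons_cons]; rw [ih cs (by simpa using h)]

/-- The number of mismatches is at most the number of targets. [folklore] -/
theorem mismatches_le_length : ∀ ts cs : List Bool, mismatches ts cs ≤ ts.length
  | [], cs => by simp
  | t :: ts, [] => by
    have := mismatches_le_length ts []
    cases t <;> simp [mismatches] <;> omega
  | t :: ts, c :: cs => by
    have := mismatches_le_length ts cs
    simp only [mismatches_cons_cons, List.length_cons]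
    split_ifs <;> omega

/-- **Averaging over the random initial assignment**: `𝔼_{cs} ρ^{mismatches ts cs} =
((1 + ρ)/2)^{|ts|}` — each coin independently matches its target with probability `1/2`.
(Fomin–Kratsch 2010, proof of Lemma 8.1: `Σ_j C(n,j) 2^{-n} (1/(k-1))^j = (1 + 1/(k-1))^n 2^{-n}`;
here coordinatewise, without binomial coefficients.) [cite: FominKratsch2010, Lemma 8.1 (proof)] -/
theorem uniformAvg_rho_pow_mismatches (ρ : ℝ) (ts : List Bool) :
    uniformAvg ts.length (fun cs => ρ ^ mismatches ts cs) = ((1 + ρ) / 2) ^ ts.length := by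
  induction ts with
  | nil => simp
  | cons t ts ih =>
    rw [List.length_cons, uniformAvg_succ]
    have e : ∀ b : Bool, uniformAvg ts.length (fun cs => ρ ^ mismatches (t :: ts) (b :: cs)) =
        ρ ^ (if b = t then 0 else 1) * ((1 + ρ) / 2) ^ ts.length := by
      intro b
      rw [← ih, ← uniformAvg_mul_left]
      congr 1; funext cs
      rw [mismatches_cons_cons, pow_add]
    rw [e, e]
    cases t <;> simp <;> ring

/-! ### Independent repetitions -/

section Trials

variable (B : ℕ) (trial : List Bool → Bool)

/-- `trials B trial t c`: one of `t` consecutive trials succeeds, the `i`-th trial reading the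
`i`-th block of `B` coins of `c`. [folklore] -/
def trials : ℕ → List Bool → Bool
  | 0, _ => false
  | t + 1, c => trial (c.take B) || trials t (c.drop B)

/-- No trials, no success. [folklore] -/
@[simp] theorem trials_zero (c : List Bool) : trials B trial 0 c = false := rfl

/-- One more trial. [folklore] -/
theorem trials_succ (t : ℕ) (c : List Bool) :
    trials B trial (t + 1) c = (trial (c.take B) || trials B trial t (c.drop B)) := rfl

/-- `trials t` reads only the first `B · t` coins. [folklore] -/
theorem trials_append : ∀ (t : ℕ) (c e : List Bool), c.length = B * t →
    trials B trial t (c ++ e) = trials B trial t c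
  | 0, c, e, _ => rfl
  | t + 1, c, e, hc => by
    have hB : B ≤ c.length := by rw [hc, Nat.mul_succ]; omega
    rw [trials_succ, trials_succ, List.take_append_of_le_length hB,
      List.drop_append_of_le_length hB,
      trials_append t (c.drop B) e (by rw [List.length_drop, hc, Nat.mul_succ]; omega)]

variable {B trial}

/-- **Independent repetitions**: if one trial succeeds with probability at least `p` (on its
block of `B` coins), then `t` trials on disjoint blocks all fail with probability at most
`(1 - p)^t`. (Hromkovič 2001, (5.36); Fomin–Kratsch 2010, proof of Theorem 8.3.)
[cite: FominKratsch2010, Theorem 8.3 (proof)] -/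
theorem uniformAvg_trialsFail_le {p : ℝ} (hp : p ≤ uniformAvg B (fun c => ind (trial c))) :
    ∀ t : ℕ, uniformAvg (B * t) (fun c => ind (!trials B trial t c)) ≤ (1 - p) ^ t := by
  intro t
  induction t with
  | zero => simp
  | succ t ih =>
    rw [Nat.mul_succ, Nat.add_comm (B * t) B, uniformAvg_append, pow_succ, mul_comm ((1 - p) ^ t)]
    have hstep : ∀ u : List Bool, u.length = B →
        uniformAvg (B * t) (fun w => ind (!trials B trial (t + 1) (u ++ w))) ≤
          (1 - ind (trial u)) * (1 - p) ^ t := by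
      intro u hu
      have e : (fun w => ind (!trials B trial (t + 1) (u ++ w))) =
          fun w => (1 - ind (trial u)) * ind (!trials B trial t w) := by
        funext w
        rw [trials_succ, List.take_left' hu, List.drop_left' hu, Bool.not_or, ind_and, ind_not]
      rw [e, uniformAvg_mul_left]
      exact mul_le_mul_of_nonneg_left ih (by have := ind_le_one (trial u); linarith)
    refine (uniformAvg_mono hstep).trans ?_
    have e2 : uniformAvg B (fun u => (1 - ind (trial u)) * (1 - p) ^ t) =
        (1 - uniformAvg B (fun u => ind (trial u))) * (1 - p) ^ t := by
      have : (fun u => (1 - ind (trial u)) * (1 - p) ^ t) =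
          fun u => (1 - p) ^ t * 1 - (1 - p) ^ t * ind (trial u) := by funext u; ring
      rw [this, uniformAvg_sub, uniformAvg_mul_left, uniformAvg_mul_left, uniformAvg_const]; ring
    rw [e2]
    have h1p : 0 ≤ (1 - p) ^ t := by
      have : p ≤ 1 := hp.trans (uniformAvg_le_one fun l _ => ind_le_one _)
      exact pow_nonneg (by linarith) t
    exact mul_le_mul_of_nonneg_right (by linarith) h1p

/-- `(1 - p)^t ≤ e^{-pt}`, and `e^{-pt} ≤ e^{-2} < 1/3` once `pt ≥ 2`: enough repetitions
bring the failure probability below `1/3`. (Hromkovič 2001, (5.36).) [folklore] -/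
theorem one_sub_pow_le_third {p : ℝ} (hp1 : p ≤ 1) {t : ℕ} (hpt : 2 ≤ p * t) :
    (1 - p) ^ t < 1 / 3 := by
  have h1 : 1 - p ≤ Real.exp (-p) := by have := Real.add_one_le_exp (-p); linarith
  have h2 : (1 - p) ^ t ≤ Real.exp (-p) ^ t := pow_le_pow_left₀ (by linarith) h1 t
  have h3 : Real.exp (-p) ^ t = Real.exp (-(p * t)) := by
    rw [← Real.exp_nat_mul]; congr 1; ring
  have h4 : Real.exp (-(p * t)) ≤ Real.exp (-2) := Real.exp_le_exp.2 (by linarith)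
  have h5 : Real.exp (-2) < 1 / 3 := by
    rw [Real.exp_neg, one_div]
    have h2e : (2 : ℝ) ≤ Real.exp 1 := by have := Real.add_one_le_exp (1 : ℝ); linarith
    have h3e : (3 : ℝ) < Real.exp 2 := by
      have : Real.exp 2 = Real.exp 1 * Real.exp 1 := by rw [← Real.exp_add]; norm_num
      rw [this]; nlinarith
    exact inv_strictAnti₀ (by norm_num) h3e
  calc (1 - p) ^ t ≤ Real.exp (-(p * t)) := h2.trans_eq h3
    _ ≤ Real.exp (-2) := h4
    _ < 1 / 3 := h5

end Trials

end Literature.Computability.FineGrained.Schoening
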